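import Mathlib
import Literature.Computability.Complexity.CliqueTestGraphs
import Summits.PneNP.PneNP.Theorems.ConvexRankGatesConvexGateBlindExponentDown
import Summits.PneNP.PneNP.Theorems.ConvexRankGatesConvexGateBlindMatchingMinor
import Summits.PneNP.PneNP.Theorems.ConvexRankGatesConvexGateBlindEpsMonotone
import Summits.PneNP.PneNP.Theorems.ConvexRankGatesConvexGateBlindCanonicalForm

/-!
# Crux `ConvexGateBlind` (stmt-PneNP-10680): the PERFECT-MATCHING CORE — one hypothesis about matchings closes the crux

Helpers (`--supports stmt-PneNP-10680`; prover seat 2, session 27). The tree's matching minor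
(`…MatchingHost` / `…MatchingMinor`: host = hub + disjointness graph on `E(K_n)`; for a perfect matching `M` of
`K_{2h}` and an odd `U`, `cdist (row M) (col U) = |M ∩ δ(U)|` EXACTLY, `cdist_mRow_cVec`) was used there only at the
unit potential `ε = 1` and for the LP cone `q = 0` (Rothvoss's slack matrix inside `D − J`). Since the identity is
exact, the SAME minor transfers every shift `ε` and the whole hybrid cone `PSD_q ⊕ ℝ^r_{≥0}`:

* `PMConeFact n q r ε` — the shifted odd-cut crossing matrix `(|M ∩ δ(U)| − ε)_{U odd, M perfect matching of K_n}`
  factorises through `PSD_q ⊕ ℝ^r_{≥0}` (Hrubeš's `M₊(PERFECT-MATCHING) − εJ` on the complements of odd cuts);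
* `pmConeFact_of_coneFactorisable(_pad)` — a cone factorisation of `D_{m,h+1+p} − εJ` restricts to one of the
  matching matrix of `K_{2h}` with the same `(q, r, ε)` whenever `C(2h,2) + 1 + p ≤ m`;
* `coneFactorisable_hard_of_pm_hard` — if the matching matrices are hard ε-UNIFORMLY for small shifts
  (`∀ c, ∀ᶠ h, ∀ ε ∈ (0, h^{-c}], ∀ q + r ≤ h^c, ¬ PMConeFact (2h) q r ε`), then for EVERY `δ ∈ (0, 1/2]` the
  canonical family `D_{m,⌈m^δ⌉} − εJ` of the crux has no cone factorisation of size `m^c`, for every `c`,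
  eventually, for every `ε > 0` (isolated/apex padding; `ε`-monotonicity `cliqueDist_coneFactorisation_of_le` to
  reach small shifts; `ε > 1` is vacuous by `cliqueDist_noConeFactorisation_of_one_lt`);
* `cliqueDistConeRankHard_of_pm_hard`, `convexGateBlind_of_pm_hard` — hence the canonical form at every
  `δ ∈ (0,1/2]` and the crux `ConvexGateBlind` itself (a LINE with ONE stub, about MATCHINGS, not cliques);
* `lp_hard_of_pm_lp_hard` — the LP slice alone (`q = 0` on both sides).

Calibration of the stub (memo ANALYSIS-seat2-s27.md): its LP unit level `ε = 1` is Rothvoss's theorem (IN THE TREE,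
`rothvoss_matching_slack_bound_holds`); the LP band `ε ∈ (1 − λ₀, 1]` is Braun–Pokutta 2015 (print, not in the tree);
fixed small `ε` and `ε → 0⁺` (`= sep₊(PERFECT-MATCHING)`, an instance of Hrubeš 2020 Open Problem 3) are open; the PSD
unit level contains the open problem "SDP extension complexity of the perfect matching polytope"; the degree-2 PSD
certificate `|M ∩ δ(U)| = sᵀ((I − A_M)/4)s` (`s = ±1_U`) fails at every `ε > 0` by exactly `ε/(2h)` (parity of `#U`).
Everything here is finite combinatorics plus filter bookkeeping. [folklore]
-/

set_option linter.dupNamespace false -- `Summit.PneNP.PneNP.…`: summit = sub-problem (D-0017)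

namespace Summit.PneNP.PneNP.Cruxes.ConvexGateBlind.StrictRankConicCover

open Matrix Finset Filter Literature.Computability.Complexity

noncomputable section

/-! ## §1 The matching-side factorisation predicate and the minor at every shift -/

/-- `PMConeFact n q r ε`: the shifted odd-cut crossing matrix `(|M ∩ δ(U)| − ε)` of `K_n` (rows: odd vertex sets
`U`, columns: perfect matchings `M`; the factor functions are total, the identity is required only there) factorises
through the cone `PSD_q ⊕ ℝ^r_{≥0}`: `|M ∩ δ(U)| − ε = tr(H_U Y_M) + ∑_{i<r} a_U(i) b_M(i)` with `H_U, Y_M ⪰ 0`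
(`q × q`) and `a, b ≥ 0`. For `q = 0`, `ε = 1` this is a non-negative factorisation of Rothvoss's odd-cut slack
matrix in the literal shape of `Literature.Computability.Complexity.rothvoss_matching_slack_bound`. [folklore] -/
def PMConeFact (n q r : ℕ) (ε : ℝ) : Prop :=
  ∃ (H : Finset (Fin n) → Matrix (Fin q) (Fin q) ℝ) (Y : (⊤ : SimpleGraph (Fin n)).Subgraph → Matrix (Fin q) (Fin q) ℝ)
    (a : Finset (Fin n) → Fin r → ℝ) (b : (⊤ : SimpleGraph (Fin n)).Subgraph → Fin r → ℝ),
    (∀ U : Finset (Fin n), Odd U.card → (H U).PosSemidef) ∧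
    (∀ M : (⊤ : SimpleGraph (Fin n)).Subgraph, M.IsPerfectMatching → (Y M).PosSemidef) ∧
    (∀ U i, 0 ≤ a U i) ∧ (∀ M i, 0 ≤ b M i) ∧
    ∀ (U : Finset (Fin n)) (M : (⊤ : SimpleGraph (Fin n)).Subgraph), Odd U.card → M.IsPerfectMatching →
      ((M.edgeSet ∩ {e | ∃ x ∈ U, ∃ y ∉ U, e = s(x, y)}).ncard : ℝ) - ε =
        (H U * Y M).trace + ∑ i, a U i * b M i

/-- **The minor at every shift, hybrid cone.** A `(PSD_q ⊕ ℝ^r_{≥0})`-factorisation of `D − εJ` at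
`(m, k) = (C(2h,2) + 1, h + 1)` restricts, along rows `row(M)` (perfect matchings `M` of `K_{2h}`) and columns
`col(U)` (`#U` odd), to a `(PSD_q ⊕ ℝ^r_{≥0})`-factorisation of the shifted odd-cut crossing matrix
`|M ∩ δ(U)| − ε` — same `q`, `r`, `ε`. [folklore] -/
theorem pmConeFact_of_coneFactorisable {h q r : ℕ} {ε : ℝ}
    (hf : ConeFactorisable (NE (2 * h) + 1) (h + 1) q r (fun _ => ε) (fun _ => 1)) :
    PMConeFact (2 * h) q r ε := by
  classical
  obtain ⟨H, Y, Uc, Vc, hH, hY, hU, hV, hfact⟩ := hf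
  refine ⟨fun U => H (cVec U), fun M => Y (mRow (pmEdges M)), fun U i => Uc (cVec U) i,
    fun M i => Vc i (mRow (pmEdges M)), fun U hUodd => hH _ (cliqueFn_cVec hUodd rfl),
    fun M hM => hY _ (by rw [card_mRow, card_pmEdges hM rfl]), fun U i => hU _ _, fun M i => hV _ _,
    fun U M hUodd hM => ?_⟩
  have hrow : (mRow (pmEdges M)).card = h + 1 := by rw [card_mRow, card_pmEdges hM rfl]
  have hid := hfact (mRow (pmEdges M)) (cVec U) hrow (cliqueFn_cVec hUodd rfl)
  rw [cdist_mRow_cVec (pmEdges_pairwise hM.1) U, mul_one] at hid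
  rw [ncard_cut_eq U]
  convert hid using 2

/-- **Padded form.** If `1 ≤ h` and `C(2h,2) + 1 + p ≤ m`, a `(PSD_q ⊕ ℝ^r_{≥0})`-factorisation of
`D_{m, h+1+p} − εJ` yields `PMConeFact (2h) q r ε` (apex/isolated padding `coneFactorisable_pad`, then the minor).
[folklore] -/
theorem pmConeFact_of_coneFactorisable_pad {m h p q r : ℕ} {ε : ℝ} (hh : 1 ≤ h)
    (hfit : (2 * h).choose 2 + 1 + p ≤ m) (hf : ConeFactorisable m (h + 1 + p) q r (fun _ => ε) (fun _ => 1)) :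
    PMConeFact (2 * h) q r ε := by
  rw [← NE_eq] at hfit
  exact pmConeFact_of_coneFactorisable (coneFactorisable_pad hfit (by omega : 2 ≤ h + 1) hf)

/-! ## §2 Numerics of the padding and of the size budget (`k = ⌈m^δ⌉₊`, `δ ≤ 1/2`) -/

/-- Eventually `k = ⌈m^δ⌉₊ ≥ 8`, `k ≤ m`, and with `h = ⌊(k-2)/2⌋` the host on `C(2h,2) + 1` vertices plus
`k - (h+1)` apexes fits into `m` vertices (`0 < δ ≤ 1/2`: `k < m^δ + 1 ≤ √m + 1`). [folklore] -/
theorem eventually_pm_fits {δ : ℝ} (hδ : 0 < δ) (hδ2 : δ ≤ 1 / 2) :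
    ∀ᶠ m : ℕ in atTop, 8 ≤ ⌈(m : ℝ) ^ δ⌉₊ ∧ ⌈(m : ℝ) ^ δ⌉₊ ≤ m ∧
      (2 * ((⌈(m : ℝ) ^ δ⌉₊ - 2) / 2)).choose 2 + 1 +
        (⌈(m : ℝ) ^ δ⌉₊ - ((⌈(m : ℝ) ^ δ⌉₊ - 2) / 2 + 1)) ≤ m := by
  have hpow : Tendsto (fun m : ℕ => (m : ℝ) ^ δ) atTop atTop :=
    (tendsto_rpow_atTop hδ).comp tendsto_natCast_atTop_atTop
  have hceil : Tendsto (fun m : ℕ => ⌈(m : ℝ) ^ δ⌉₊) atTop atTop := tendsto_nat_ceil_atTop.comp hpow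
  filter_upwards [hceil.eventually_ge_atTop 8, eventually_ge_atTop 1] with m hk8 hm1
  set k : ℕ := ⌈(m : ℝ) ^ δ⌉₊ with hk
  set h : ℕ := (k - 2) / 2 with hh
  have hm0 : (0 : ℝ) ≤ m := Nat.cast_nonneg m
  have hm1r : (1 : ℝ) ≤ m := by exact_mod_cast hm1
  have hx0 : (0 : ℝ) ≤ (m : ℝ) ^ (1 / 2 : ℝ) := by positivity
  have hsq : ((m : ℝ) ^ (1 / 2 : ℝ)) ^ 2 = m := by
    rw [← Real.rpow_natCast, ← Real.rpow_mul hm0]; norm_num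
  have hδle : (m : ℝ) ^ δ ≤ (m : ℝ) ^ (1 / 2 : ℝ) := Real.rpow_le_rpow_of_exponent_le hm1r hδ2
  have hklt : (k : ℝ) < (m : ℝ) ^ δ + 1 := Nat.ceil_lt_add_one (by positivity)
  have hkge : (m : ℝ) ^ δ ≤ k := Nat.le_ceil _
  have h2h : 2 * h ≤ k - 2 := by omega
  have hNE : (2 * h).choose 2 ≤ (k - 2) ^ 2 :=
    (Nat.choose_le_pow _ _).trans (Nat.pow_le_pow_left h2h 2)
  have hreal : (((k - 2) ^ 2 + 1 + k : ℕ) : ℝ) ≤ m := by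
    push_cast [Nat.cast_sub (show 2 ≤ k by omega)]
    have h7 : (7 : ℝ) ≤ (m : ℝ) ^ (1 / 2 : ℝ) := by
      have : (8 : ℝ) ≤ k := by exact_mod_cast hk8
      linarith
    nlinarith [hsq, hklt, hkge, h7, hδle]
  have hnat : (k - 2) ^ 2 + 1 + k ≤ m := by exact_mod_cast hreal
  refine ⟨hk8, by omega, ?_⟩
  omega

/-- Eventually `m^c + 1 ≤ h^{c'}` for `h = ⌊(⌈m^δ⌉₊ - 2)/2⌋` and `c' = ⌈(c+1)/δ⌉₊` (`h ≥ (m^δ - 3)/2 ≥ m^δ/4` and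
`δ c' ≥ c + 1`). [folklore] -/
theorem eventually_pow_succ_le_half_pow (c : ℕ) {δ : ℝ} (hδ : 0 < δ) :
    ∀ᶠ m : ℕ in atTop, m ^ c + 1 ≤ ((⌈(m : ℝ) ^ δ⌉₊ - 2) / 2) ^ ⌈((c : ℝ) + 1) / δ⌉₊ := by
  have hpow : Tendsto (fun m : ℕ => (m : ℝ) ^ δ) atTop atTop :=
    (tendsto_rpow_atTop hδ).comp tendsto_natCast_atTop_atTop
  set c' : ℕ := ⌈((c : ℝ) + 1) / δ⌉₊ with hc'
  have hc'δ : (c : ℝ) + 1 ≤ δ * c' := by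
    have h1 : ((c : ℝ) + 1) / δ ≤ c' := Nat.le_ceil _
    rwa [div_le_iff₀ hδ, mul_comm] at h1
  filter_upwards [hpow.eventually_ge_atTop 6, eventually_ge_atTop (2 * 4 ^ c')] with m hx6 hm
  set x : ℝ := (m : ℝ) ^ δ with hx
  set k : ℕ := ⌈(m : ℝ) ^ δ⌉₊ with hk
  set h : ℕ := (k - 2) / 2 with hh
  have h4c : 1 ≤ 4 ^ c' := Nat.one_le_pow c' 4 (by norm_num)
  have hm1 : 1 ≤ m := by omega
  have hm1r : (1 : ℝ) ≤ m := by exact_mod_cast hm1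
  have hkge : x ≤ k := Nat.le_ceil _
  -- `h ≥ (x - 3)/2 ≥ x/4 ≥ 0`
  have h2h : k ≤ 2 * h + 3 := by omega
  have hhx : x / 4 ≤ (h : ℝ) := by
    have : (k : ℝ) ≤ 2 * (h : ℝ) + 3 := by exact_mod_cast h2h
    linarith
  have hx4 : (0 : ℝ) ≤ x / 4 := by positivity
  -- `(x/4)^{c'} ≤ h^{c'}` and `x^{c'} ≥ m^{c+1}`
  have hpow1 : (x / 4) ^ c' ≤ (h : ℝ) ^ c' := pow_le_pow_left₀ hx4 hhx c'
  have hxc : (m : ℝ) ^ ((c : ℝ) + 1) ≤ x ^ c' := by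
    rw [hx, ← Real.rpow_natCast, ← Real.rpow_mul (Nat.cast_nonneg m)]
    exact Real.rpow_le_rpow_of_exponent_le hm1r hc'δ
  have hmc1 : (m : ℝ) ^ ((c : ℝ) + 1) = (m : ℝ) ^ c * m := by
    rw [Real.rpow_add (by positivity), Real.rpow_natCast, Real.rpow_one]
  -- `m^c + 1 ≤ m^{c+1} / 4^{c'}` as `m ≥ 2·4^{c'}`
  have h4 : (0 : ℝ) < (4 : ℝ) ^ c' := by positivity
  have hmr : (2 : ℝ) * 4 ^ c' ≤ m := by exact_mod_cast hm
  have hmc0 : (1 : ℝ) ≤ (m : ℝ) ^ c := one_le_pow₀ hm1r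
  have hreal : ((m ^ c + 1 : ℕ) : ℝ) ≤ (h : ℝ) ^ c' := by
    push_cast
    have step : ((m : ℝ) ^ c + 1) * 4 ^ c' ≤ (m : ℝ) ^ c * m := by nlinarith
    have step2 : ((m : ℝ) ^ c + 1) ≤ (x / 4) ^ c' := by
      rw [div_pow, le_div_iff₀ h4]
      calc ((m : ℝ) ^ c + 1) * 4 ^ c' ≤ (m : ℝ) ^ c * m := step
        _ = (m : ℝ) ^ ((c : ℝ) + 1) := hmc1.symm
        _ ≤ x ^ c' := hxc
    exact step2.trans hpow1
  exact_mod_cast hreal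

/-! ## §3 The transfer: matching hardness ⟹ the canonical family of the crux is hard, every `δ ≤ 1/2` -/

/-- **Finite-size transfer.** Let `k ≥ 8`, `h = ⌊(k-2)/2⌋`, the host fit into `m` vertices, and `m^c + 1 ≤ h^{c'}`.
A `(PSD_q ⊕ ℝ^r_{≥0})`-factorisation of `D_{m,k} − εJ` with `0 < ε` and `q + r ≤ m^c` yields, for the shift
`ε' = min ε (h^{c'})⁻¹ ∈ (0, (h^{c'})⁻¹]`, a factorisation `PMConeFact (2h) q (r+1) ε'` with `q + (r+1) ≤ h^{c'}`
(lower the shift by one extra LP term, pad, restrict to the minor). [folklore] -/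
theorem pm_transfer {m k c c' q r : ℕ} {ε : ℝ} (hk8 : 8 ≤ k)
    (hfit : (2 * ((k - 2) / 2)).choose 2 + 1 + (k - ((k - 2) / 2 + 1)) ≤ m)
    (hsize : m ^ c + 1 ≤ ((k - 2) / 2) ^ c') (hε : 0 < ε) (hqr : q + r ≤ m ^ c)
    (hf : ConeFactorisable m k q r (fun _ => ε) (fun _ => 1)) :
    ∃ ε' : ℝ, 0 < ε' ∧ ε' ≤ (((((k - 2) / 2 : ℕ) : ℝ)) ^ c')⁻¹ ∧ q + (r + 1) ≤ ((k - 2) / 2) ^ c' ∧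
      PMConeFact (2 * ((k - 2) / 2)) q (r + 1) ε' := by
  set h : ℕ := (k - 2) / 2 with hh
  have hh1 : 1 ≤ h := by omega
  have hhpos : (0 : ℝ) < ((h : ℝ)) ^ c' := by positivity
  set ε' : ℝ := min ε (((h : ℝ)) ^ c')⁻¹ with hε'
  refine ⟨ε', lt_min hε (inv_pos.2 hhpos), min_le_right _ _, by omega, ?_⟩
  -- lower the shift from `ε` to `ε' ≤ ε` at the cost of one LP term
  obtain ⟨H, Y, U, V, hH, hY, hU, hV, hfact⟩ := hf
  have hfact1 : ∀ (Q : Finset (Fin m)) (u : Edge m → Bool), Q.card = k → cliqueFn m k u = false →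
      (∑ e, if cliqueVec Q e = true ∧ u e = false then (1 : ℝ) else 0) - ε =
        (H u * Y Q).trace + ∑ l, U u l * V l Q := fun Q u hQ hu => by
    have := hfact Q u hQ hu
    rwa [mul_one] at this
  obtain ⟨U', V', hU', hV', hfact'⟩ :=
    Summit.PneNP.PneNP.Theorems.cliqueDist_coneFactorisation_of_le (min_le_left _ _ : ε' ≤ ε) H Y U V hU hV hfact1
  have hf' : ConeFactorisable m k q (r + 1) (fun _ => ε') (fun _ => 1) :=
    ⟨H, Y, U', V', hH, hY, hU', hV', fun Q u hQ hu => by rw [mul_one]; exact hfact' Q u hQ hu⟩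
  -- pad and restrict: `k = h + 1 + p`
  have hkp : h + 1 + (k - (h + 1)) = k := by omega
  rw [← hkp] at hf'
  exact pmConeFact_of_coneFactorisable_pad hh1 hfit hf'

/-- **Matching hardness ⟹ the canonical family is hard, in the line's vocabulary.** If the shifted odd-cut crossing
matrices of `K_{2h}` admit no `(PSD_q ⊕ ℝ^r_{≥0})`-factorisation of size `h^c` for small shifts
`ε ∈ (0, h^{-c}]`, ε-UNIFORMLY (every `c`, eventually in `h`), then for every `δ ∈ (0, 1/2]`, every `c`, eventually
in `m`, for EVERY `ε > 0`: `¬ ConeFactorisable m ⌈m^δ⌉₊ q r ε 1` whenever `q + r ≤ m^c`. [folklore] -/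
theorem coneFactorisable_hard_of_pm_hard :
    (∀ c : ℕ, ∀ᶠ h : ℕ in atTop, ∀ ε : ℝ, 0 < ε → ε ≤ ((h : ℝ) ^ c)⁻¹ →
      ∀ q r : ℕ, q + r ≤ h ^ c → ¬ PMConeFact (2 * h) q r ε) →
    ∀ {δ : ℝ}, 0 < δ → δ ≤ 1 / 2 →
      ∀ c : ℕ, ∀ᶠ m : ℕ in atTop, ∀ ε : ℝ, 0 < ε → ∀ q r : ℕ, q + r ≤ m ^ c →
        ¬ ConeFactorisable m ⌈(m : ℝ) ^ δ⌉₊ q r (fun _ => ε) (fun _ => 1) := by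
  intro hPM δ hδ hδ2 c
  set c' : ℕ := ⌈((c : ℝ) + 1) / δ⌉₊ with hc'
  have hpow : Tendsto (fun m : ℕ => (m : ℝ) ^ δ) atTop atTop :=
    (tendsto_rpow_atTop hδ).comp tendsto_natCast_atTop_atTop
  have hceil : Tendsto (fun m : ℕ => ⌈(m : ℝ) ^ δ⌉₊) atTop atTop := tendsto_nat_ceil_atTop.comp hpow
  have hhalf : Tendsto (fun k : ℕ => (k - 2) / 2) atTop atTop :=
    tendsto_atTop_atTop.2 fun b => ⟨2 * b + 2, fun k hk => by omega⟩
  have hH : Tendsto (fun m : ℕ => (⌈(m : ℝ) ^ δ⌉₊ - 2) / 2) atTop atTop := hhalf.comp hceil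
  filter_upwards [hH.eventually (hPM c'), eventually_pm_fits hδ hδ2, eventually_pow_succ_le_half_pow c hδ]
    with m hPMm hfit hsize
  obtain ⟨hk8, hkm, hfit⟩ := hfit
  intro ε hε q r hqr hf
  by_cases hε1 : 1 < ε
  · -- `ε > 1`: vacuous (a critical pair has distance `1`)
    obtain ⟨H, Y, U, V, hHp, hYp, hU, hV, hfact⟩ := hf
    refine Summit.PneNP.PneNP.Theorems.cliqueDist_noConeFactorisation_of_one_lt (by omega) hkm hε1
      H Y U V hHp hYp hU hV fun Q u hQ hu => ?_
    have := hfact Q u hQ hu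
    rwa [mul_one] at this
  · obtain ⟨ε', hε'pos, hε'le, hqr', hPMf⟩ := pm_transfer hk8 hfit hsize hε hqr hf
    exact hPMm ε' hε'pos hε'le q (r + 1) hqr' hPMf

/-- **The LP slice alone.** If the shifted odd-cut crossing matrices have no NON-NEGATIVE factorisation
(`q = 0`) of size `h^c` for small shifts, ε-uniformly, then the LP slice of the canonical family is hard at every
`δ ∈ (0, 1/2]`: eventually `¬ ConeFactorisable m ⌈m^δ⌉₊ 0 r ε 1` for `r ≤ m^c`, every `ε > 0`. (Its unit level
`ε = 1` is Rothvoss's theorem, `…UnitPotentialLPHolds`; the band `ε ∈ (1 − λ₀, 1]` is Braun–Pokutta 2015; the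
limit `ε → 0⁺` is `sep₊(PERFECT-MATCHING)`, an instance of Hrubeš's Open Problem 3.) [folklore] -/
theorem lp_hard_of_pm_lp_hard
    (hPM : ∀ c : ℕ, ∀ᶠ h : ℕ in atTop, ∀ ε : ℝ, 0 < ε → ε ≤ ((h : ℝ) ^ c)⁻¹ →
      ∀ r : ℕ, r ≤ h ^ c → ¬ PMConeFact (2 * h) 0 r ε)
    {δ : ℝ} (hδ : 0 < δ) (hδ2 : δ ≤ 1 / 2) :
    ∀ c : ℕ, ∀ᶠ m : ℕ in atTop, ∀ ε : ℝ, 0 < ε → ∀ r : ℕ, r ≤ m ^ c →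
      ¬ ConeFactorisable m ⌈(m : ℝ) ^ δ⌉₊ 0 r (fun _ => ε) (fun _ => 1) := by
  have hPM' : ∀ c : ℕ, ∀ᶠ h : ℕ in atTop, ∀ ε : ℝ, 0 < ε → ε ≤ ((h : ℝ) ^ c)⁻¹ →
      ∀ q r : ℕ, q = 0 → q + r ≤ h ^ c → ¬ PMConeFact (2 * h) q r ε := fun c =>
    (hPM c).mono fun h hh ε hε hεle q r hq hqr => by
      subst hq
      exact hh ε hε hεle r (by simpa using hqr)
  intro c
  set c' : ℕ := ⌈((c : ℝ) + 1) / δ⌉₊ with hc'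
  have hpow : Tendsto (fun m : ℕ => (m : ℝ) ^ δ) atTop atTop :=
    (tendsto_rpow_atTop hδ).comp tendsto_natCast_atTop_atTop
  have hceil : Tendsto (fun m : ℕ => ⌈(m : ℝ) ^ δ⌉₊) atTop atTop := tendsto_nat_ceil_atTop.comp hpow
  have hhalf : Tendsto (fun k : ℕ => (k - 2) / 2) atTop atTop :=
    tendsto_atTop_atTop.2 fun b => ⟨2 * b + 2, fun k hk => by omega⟩
  have hH : Tendsto (fun m : ℕ => (⌈(m : ℝ) ^ δ⌉₊ - 2) / 2) atTop atTop := hhalf.comp hceil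
  filter_upwards [hH.eventually (hPM' c'), eventually_pm_fits hδ hδ2, eventually_pow_succ_le_half_pow c hδ]
    with m hPMm hfit hsize
  obtain ⟨hk8, hkm, hfit⟩ := hfit
  intro ε hε r hr hf
  by_cases hε1 : 1 < ε
  · obtain ⟨H, Y, U, V, hHp, hYp, hU, hV, hfact⟩ := hf
    refine Summit.PneNP.PneNP.Theorems.cliqueDist_noConeFactorisation_of_one_lt (by omega) hkm hε1
      H Y U V hHp hYp hU hV fun Q u hQ hu => ?_
    have := hfact Q u hQ hu
    rwa [mul_one] at this
  · obtain ⟨ε', hε'pos, hε'le, hqr', hPMf⟩ := pm_transfer hk8 hfit hsize hε (by simpa using hr) hf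
    exact hPMm ε' hε'pos hε'le 0 (r + 1) rfl hqr' hPMf

end

end Summit.PneNP.PneNP.Cruxes.ConvexGateBlind.StrictRankConicCover

/-! ## §4 The crux from matching hardness -/

namespace Summit.PneNP.PneNP.Theorems

open Matrix Finset Filter Literature.Computability.Complexity
open Summit.PneNP.PneNP.Cruxes.ConvexGateBlind.StrictRankConicCover

/-- **The canonical form at every `δ ∈ (0, 1/2]` from matching hardness.** Under the ε-uniform hybrid hardness of
the shifted odd-cut crossing matrices (small shifts only), the right-hand side of
`convexGateBlind_iff_cliqueDistConeRankHard` holds at every `δ ∈ (0, 1/2]`. [folklore] -/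
theorem cliqueDistConeRankHard_of_pm_hard
    (hPM : ∀ c : ℕ, ∀ᶠ h : ℕ in atTop, ∀ ε : ℝ, 0 < ε → ε ≤ ((h : ℝ) ^ c)⁻¹ →
      ∀ q r : ℕ, q + r ≤ h ^ c → ¬ PMConeFact (2 * h) q r ε)
    {δ : ℝ} (hδ : 0 < δ) (hδ2 : δ ≤ 1 / 2) :
    ∀ c : ℕ, ∀ᶠ m : ℕ in atTop, ∀ ε : ℝ, 0 < ε → ∀ (q r : ℕ), q + r ≤ m ^ c →
      ∀ (H : ((⊤ : SimpleGraph (Fin m)).edgeSet → Bool) → Matrix (Fin q) (Fin q) ℝ)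
        (Y : Finset (Fin m) → Matrix (Fin q) (Fin q) ℝ)
        (U : ((⊤ : SimpleGraph (Fin m)).edgeSet → Bool) → Fin r → ℝ) (V : Fin r → Finset (Fin m) → ℝ),
        (∀ u, cliqueFn m ⌈(m : ℝ) ^ δ⌉₊ u = false → (H u).PosSemidef) →
        (∀ Q : Finset (Fin m), Q.card = ⌈(m : ℝ) ^ δ⌉₊ → (Y Q).PosSemidef) →
        (∀ u l, 0 ≤ U u l) → (∀ l Q, 0 ≤ V l Q) →
        ¬ ∀ (Q : Finset (Fin m)) (u : (⊤ : SimpleGraph (Fin m)).edgeSet → Bool), Q.card = ⌈(m : ℝ) ^ δ⌉₊ →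
            cliqueFn m ⌈(m : ℝ) ^ δ⌉₊ u = false →
            (∑ e, if cliqueVec Q e = true ∧ u e = false then (1 : ℝ) else 0) - ε =
              (H u * Y Q).trace + ∑ l, U u l * V l Q := by
  intro c
  filter_upwards [coneFactorisable_hard_of_pm_hard hPM hδ hδ2 c] with m hm
  intro ε hε q r hqr H Y U V hH hY hU hV hall
  exact hm ε hε q r hqr ⟨H, Y, U, V, hH, hY, hU, hV, fun Q u hQ hu => by rw [mul_one]; exact hall Q u hQ hu⟩

/-- **`ConvexGateBlind` from ONE statement about perfect matchings** (a line with one stub). If for every `c`,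
eventually in `h`, for every shift `ε ∈ (0, h^{-c}]` the matrix `(|M ∩ δ(U)| − ε)_{U odd, M perfect matching of K_{2h}}`
has no `(PSD_q ⊕ ℝ^r_{≥0})`-factorisation with `q + r ≤ h^c`, then no polynomial-size `{AND₂, OR₂} + CONV` circuit
computes `CLIQUE(m, ⌈m^δ⌉)` (`δ = 1/4`, indeed any `δ ∈ (0,1/2)`): the crux of route ConvexRankGates. [folklore] -/
theorem convexGateBlind_of_pm_hard :
    (∀ c : ℕ, ∀ᶠ h : ℕ in atTop, ∀ ε : ℝ, 0 < ε → ε ≤ ((h : ℝ) ^ c)⁻¹ →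
      ∀ q r : ℕ, q + r ≤ h ^ c → ¬ PMConeFact (2 * h) q r ε) →
    Summit.PneNP.PneNP.Theses.ConvexRankGates.ConvexGateBlind := fun hPM =>
  convexGateBlind_iff_cliqueDistConeRankHard.mpr
    ⟨1 / 4, by norm_num, by norm_num, cliqueDistConeRankHard_of_pm_hard hPM (by norm_num) (by norm_num)⟩

/-- The same with the plain hypothesis "every positive shift" (formally stronger as a hypothesis, hence a weaker
theorem; recorded for readability: `∀ c, ∀ᶠ h, ∀ ε > 0, ∀ q + r ≤ h^c, ¬ PMConeFact (2h) q r ε`). [folklore] -/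
theorem convexGateBlind_of_pm_hard'
    (hPM : ∀ c : ℕ, ∀ᶠ h : ℕ in atTop, ∀ ε : ℝ, 0 < ε → ∀ q r : ℕ, q + r ≤ h ^ c → ¬ PMConeFact (2 * h) q r ε) :
    Summit.PneNP.PneNP.Theses.ConvexRankGates.ConvexGateBlind :=
  convexGateBlind_of_pm_hard fun c => (hPM c).mono fun _ hh ε hε _ q r hqr => hh ε hε q r hqr

end Summit.PneNP.PneNP.Theorems
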